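import Mathlib
import Literature.NumberTheory.Automorphic.ClozelAlgebraicity
import Literature.NumberTheory.Automorphic.AutomorphicRepsGLSatakeFlathProofs
import Literature.NumberTheory.Automorphic.GLnCuspidalSpectrumSiegel
import HarnessLib

/-!
# Crux `HeckeEigenvalueField` (stmt-Langlands-13632) — line `BaireSketch`, stub `stub_C2`

Hecke operators on an automorphic representation `π = W / W'` of `GL_n(𝔸_K)` (Borel–Jacquet
model): for a level `K(𝔫)`, `𝔫 ≠ 0`, a place `v ∤ 𝔫`, a uniformizer `ϖ` and `i`, the operator
`T_{v,i}(ϖ) = [K(𝔫) t_{v,i}(ϖ) K(𝔫)]` maps the `K(𝔫)`-invariant forms of `W` into `W` and those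
of `W'` into `W'`, acts on the former by one scalar modulo `W'`
(`Flath1979_heckeOperator_ofLocal_sub_smul_mem_holds`), and that scalar is the unramified Hecke
eigenvalue `q_v^{i(n-i)/2} e_i(α)` of every Satake parameter `α` of `π` at `v` (`i ≤ n`).
-/


set_option linter.dupNamespace false

noncomputable section

open scoped Classical
open Literature.NumberTheory.Automorphic NumberField NumberField.mixedEmbedding IsDedekindDomain

namespace Summit.Langlands.Langlands.Theorems.HeckeEigenvalueField.Baire

variable {n : ℕ} {K : Type} [Field K] [NumberField K]

/-- **Hecke operators at an unramified place preserve `G(𝔸_f)`-stable subspaces on level-`K(𝔫)`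
vectors.** If `M` is stable under right translation by the finite-adelic group of the `GL_n`
datum, `𝔫 ≠ 0`, `v ∤ 𝔫` and `φ ∈ M` is `K(𝔫)`-invariant, then `[K(𝔫) ι_v(g) K(𝔫)] φ ∈ M` for
every `g ∈ GL_n(K_v)`: change the level to `GL_n(𝒪_v)` placed at `v`
(`heckeOperator_sphericalLevelAt_eq_principalCongruenceLevel`), restrict along
`ι_v : GL_n(K_v) ↪ GL_n(𝔸_K)` (`heckeOperator_map_apply_eq`), where double cosets are finite
(`finite_orbit_valuedCongruenceSubgroup_one`) and the operator is a finite sum of translates by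
elements of `ι_v(GL_n(K_v)) ⊆ G(𝔸_f)` (`heckeOperator_apply_mem_of_forall_apply_mem`).
[folklore] -/
theorem heckeOperator_ofLocal_apply_mem_of_finite_stable {hcpt : isCompact_glFiniteIntegralLevel n K}
    {M : Submodule ℂ ((AdelicGroupData.gl n K).Adelic → ℂ)}
    (hM : ∀ h ∈ (AutomorphyDatum.gl n K hcpt).finiteAdelic,
      M ≤ M.comap (rightTranslation (AdelicGroupData.gl n K) h))
    {𝔫 : Ideal (𝓞 K)} (h𝔫 : 𝔫 ≠ 0) {v : HeightOneSpectrum (𝓞 K)} (hv : ¬ v.asIdeal ∣ 𝔫)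
    (g : GL (Fin n) (v.adicCompletion K)) {φ : (AdelicGroupData.gl n K).Adelic → ℂ} (hφ : φ ∈ M)
    (hfix : IsRightInvariantUnder (principalCongruenceLevel n K 𝔫) φ) :
    heckeOperator (rightTranslation (AdelicGroupData.gl n K)) (principalCongruenceLevel n K 𝔫)
      (GLn.ofLocal n K v g) φ ∈ M := by
  set ρ : Representation ℂ (AdelicGroupData.gl n K).Adelic ((AdelicGroupData.gl n K).Adelic → ℂ) :=
    rightTranslation (AdelicGroupData.gl n K)
  let ι : GL (Fin n) (v.adicCompletion K) →* (AdelicGroupData.gl n K).Adelic := GLn.ofLocal n K v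
  have hιinj : Function.Injective ι := GLn.ofLocal_injective
  let K₀ : Subgroup (GL (Fin n) (v.adicCompletion K)) :=
    valuedCongruenceSubgroup (Fin n) (1 : WithZero (Multiplicative ℤ))
  have hK : (Literature.NumberTheory.Automorphic.sphericalLevelAt K n v :
      Subgroup (AdelicGroupData.gl n K).Adelic) = K₀.map ι := rfl
  let ρ₀ : Representation ℂ (GL (Fin n) (v.adicCompletion K))
      ((AdelicGroupData.gl n K).Adelic → ℂ) := ρ.comp ι
  have hιmem : ∀ t, ι t ∈ (AutomorphyDatum.gl n K hcpt).finiteAdelic := fun t =>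
    GLn.ofLocal_mem_range_ofFinite v t
  have hMρ : ∀ t, ∀ ψ ∈ M, ρ₀ t ψ ∈ M := fun t ψ hψ => hM _ (hιmem t) hψ
  have hfin := finite_orbit_valuedCongruenceSubgroup_one n K v
  have hφK : φ ∈ ρ.fixedPoints (principalCongruenceLevel n K 𝔫) :=
    (isRightInvariantUnder_iff_mem_fixedPoints _ _ _).mp hfix
  have hφK' : φ ∈ ρ.fixedPoints (Literature.NumberTheory.Automorphic.sphericalLevelAt K n v) :=
    ρ.fixedPoints_antitone (isMaximalAt_principalCongruenceLevel n K v h𝔫 hv) hφK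
  have hφKι : φ ∈ ρ.fixedPoints (K₀.map ι) := by rw [← hK]; exact hφK'
  have h1 : heckeOperator ρ (Literature.NumberTheory.Automorphic.sphericalLevelAt K n v)
        (GLn.ofLocal n K v g) φ =
      heckeOperator ρ (principalCongruenceLevel n K 𝔫) (GLn.ofLocal n K v g) φ :=
    heckeOperator_sphericalLevelAt_eq_principalCongruenceLevel ρ h𝔫 hv g hφK
  have key : heckeOperator ρ (Literature.NumberTheory.Automorphic.sphericalLevelAt K n v)
      (GLn.ofLocal n K v g) φ = heckeOperator ρ₀ K₀ g φ :=
    heckeOperator_map_apply_eq ι hιinj K₀ ρ g (hfin g) hφKι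
  rw [← h1, key]
  exact heckeOperator_apply_mem_of_forall_apply_mem ρ₀ K₀ hMρ g (hfin g) hφ

/-- **(C2) — Hecke operators on `W / W'`: stability and the scalar.** For a level `𝔫 ≠ 0`,
`v ∤ 𝔫`, a uniformizer `ϖ` and `i`: the operator `T_{v,i}(ϖ)` at level `K(𝔫)` maps the
`K(𝔫)`-invariant forms of `W` into `W` and those of `W'` into `W'`, and acts on the former by ONE
scalar modulo `W'` (`Flath1979_heckeOperator_ofLocal_sub_smul_mem_holds`), which is the unramified
Hecke eigenvalue `q_v^{i(n-i)/2} e_i(α)` of every Satake parameter `α` of `π` at `v` (`i ≤ n`).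
[folklore] -/
theorem stub_C2 {hcpt : isCompact_glFiniteIntegralLevel n K}
    (π : AutomorphicRepData (AutomorphyDatum.gl n K hcpt)) {𝔫 : Ideal (𝓞 K)} (h𝔫 : 𝔫 ≠ 0)
    {v : HeightOneSpectrum (𝓞 K)} (hv : ¬ v.asIdeal ∣ 𝔫) {ϖ : (v.adicCompletion K)ˣ}
    (hϖ : Valued.v (ϖ : v.adicCompletion K) = WithZero.exp (-1 : ℤ)) (i : ℕ) :
    (∀ φ ∈ π.W, IsRightInvariantUnder (principalCongruenceLevel n K 𝔫) φ →
      heckeOperator (rightTranslation (AdelicGroupData.gl n K)) (principalCongruenceLevel n K 𝔫)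
        (heckeDiagAt n K v ϖ i) φ ∈ π.W) ∧
    (∀ φ ∈ π.W', IsRightInvariantUnder (principalCongruenceLevel n K 𝔫) φ →
      heckeOperator (rightTranslation (AdelicGroupData.gl n K)) (principalCongruenceLevel n K 𝔫)
        (heckeDiagAt n K v ϖ i) φ ∈ π.W') ∧
    ∃ c : ℂ,
      (∀ φ ∈ π.W, IsRightInvariantUnder (principalCongruenceLevel n K 𝔫) φ →
        heckeOperator (rightTranslation (AdelicGroupData.gl n K)) (principalCongruenceLevel n K 𝔫)
          (heckeDiagAt n K v ϖ i) φ - c • φ ∈ π.W') ∧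
      ∀ α : Multiset ℂ, π.HasSatakeParamAt v α → i ≤ n → c = heckeEigenvalueOf n v α i := by
  set g : GL (Fin n) (v.adicCompletion K) :=
    glDiagonal n (v.adicCompletion K) fun k => if (k : ℕ) < i then ϖ else 1
  have hdiag : heckeDiagAt n K v ϖ i = GLn.ofLocal n K v g := heckeDiagAt_eq_ofLocal_glDiagonal ϖ i
  refine ⟨fun φ hφ hfix => ?_, fun φ hφ hfix => ?_, ?_⟩
  · rw [hdiag]
    exact heckeOperator_ofLocal_apply_mem_of_finite_stable π.stable.finite_stable h𝔫 hv g hφ hfix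
  · rw [hdiag]
    exact heckeOperator_ofLocal_apply_mem_of_finite_stable π.stable'.finite_stable h𝔫 hv g hφ hfix
  obtain ⟨c, hc⟩ := π.Flath1979_heckeOperator_ofLocal_sub_smul_mem_holds v g
  refine ⟨c, fun φ hφ hfix => ?_, fun α hα hi => ?_⟩
  · rw [hdiag]
    exact hc h𝔫 hv φ hφ fun u hu => funext fun x => hfix u hu x
  · obtain ⟨𝔫₁, ϖ₁, h𝔫₁, hv₁, hϖ₁, -, φ₁, hφ₁W, hφ₁W', hfix₁, hT₁⟩ := hα
    -- at level `K(𝔫₁)` the operators for `ϖ₁` and `ϖ` coincide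
    have hop : heckeOperator (rightTranslation (AdelicGroupData.gl n K))
        (principalCongruenceLevel n K 𝔫₁) (heckeDiagAt n K v ϖ₁ i) =
          heckeOperator (rightTranslation (AdelicGroupData.gl n K))
            (principalCongruenceLevel n K 𝔫₁) (heckeDiagAt n K v ϖ i) :=
      heckeOperator_heckeDiagAt_eq_of_valuation_eq _
        (isMaximalAt_principalCongruenceLevel n K v h𝔫₁ hv₁) (hϖ₁.trans hϖ.symm) i
    have h1 : heckeOperator (rightTranslation (AdelicGroupData.gl n K))
        (principalCongruenceLevel n K 𝔫₁) (heckeDiagAt n K v ϖ₁ i) φ₁ - c • φ₁ ∈ π.W' := by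
      rw [hop, hdiag]
      exact hc h𝔫₁ hv₁ φ₁ hφ₁W hfix₁
    exact eq_of_sub_smul_mem_of_not_mem h1 (hT₁ i hi) hφ₁W'

end Summit.Langlands.Langlands.Theorems.HeckeEigenvalueField.Baire

end
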